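import Mathlib
import HarnessLib
import Summits.HubbardSuperconductivity.HubbardSuperconductivity.Theorems.KLProgrammeKLRegimeEngineScaleZeroMultiplierPieces
import Summits.HubbardSuperconductivity.HubbardSuperconductivity.Theorems.KLProgrammeKLRegimeEngineScaleZeroE4OverlapScale

/-!
# KL programme (k = 3, c = 2, p1 g3) — ENGINE (E4)₀: the first SPACE moment of the scale-`0` sector MULTIPLIER, telescoped over the
# frame pieces (`T_X`, part 3: the pieces of an admissible frame and the telescoped bound in the grid units)

Helpers toward the item `KLRegimeEngineV16` (conjunct (E4)₀ of `stub_engine_scale0`): the multiplier twin of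
`…ScaleZeroE4SpaceMoment` §3–§4.  Inputs: p4's `ScaleZeroMultiplierBandPieces` (`spaceMoment_multBasePiece_le`,
`spaceMoment_multIncrPiece_le`, `paddedPiece`, `multAmp`) and `…ScaleZeroMultiplierPieces` (`frameBandInterp_offShell_of_frameOK`,
`frameLevel_zero_offShell_of_window`, `norm_iteratedFDeriv_framePiece_mul_le`), `…ScaleZeroE4Bands` (the partial frame bands and their
derivative bounds), `…ScaleZeroE4OverlapScale` (`scaledMultAmp_le`: every term `O(U²)` or `O(|U|/2ᵐ)` at the scale `R_m = 4ᵐ`):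

* `multAmp_nonneg`, `framePieceW_bound` (the product table in the `2ᵐ` form);
* **`spaceMoment_multIncrPiece_frame_le`** (`m ≤ N_sc`), **`spaceMoment_multBasePiece_frame_le`**;
* **`spaceMoment_multiplier_padded_le`** — `(β/N)·Σ_{a,b⃗}|b̃_l|·‖S[P_{N_sc+1}](a,b⃗)‖ ≤ C₀'(B,W_A) + C₁'(B)·W_A·36864·S⁴·((N_sc+1)U² + 2|U|)`
  for the padded multiplier piece `P_{N_sc+1}` of the full frame band with the angular factor `zoneAngularRaw 1 (1/4) 0 ω`.
-/

noncomputable section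

namespace Summit.HubbardSuperconductivity.HubbardSuperconductivity.Theorems.EngineV8

set_option linter.dupNamespace false -- summit = problem name (single-conjunct summit), D-0017

open Real Finset Literature.MathematicalPhysics.QuantumLattice Literature.Probability.LatticeModels
open Summit.HubbardSuperconductivity.HubbardSuperconductivity.Theorems.KLRegimeSplit
open Summit.HubbardSuperconductivity.HubbardSuperconductivity.Theorems.DispersionFlow
open scoped Nat

variable {L M N : ℕ}

/-! ## §1 Bookkeeping -/

/-- The multiplier amplitudes are non-negative. -/
theorem multAmp_nonneg {B e₀ D : ℝ} (hB : 0 ≤ B) (he : 0 < e₀) (hD : 0 ≤ D) {W : ℕ → ℝ} (hW : ∀ i, 0 ≤ W i) (m k : ℕ) :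
    0 ≤ multAmp B e₀ D W m k := by
  unfold multAmp
  refine mul_nonneg (by positivity) (sum_nonneg fun j _ => ?_)
  have := hW (k - j)
  positivity

/-- **The product table in the `2ᵐ` form**: `‖Dⁱ(−Kₘ·Ã)‖ ≤ W_A·Σ_{j≤i} C(i,j)·Gfr j·u_j(U)·(2ᵐ)^{2j}/(2ᵐ)⁴` (`i ≤ 3`). -/
theorem framePieceW_bound {R : RenConsts} {U : ℝ} {Nsc : ℕ} {Kp : ℕ → TrigPolyC4v}
    (hS : ∀ n ≤ Nsc, ∀ j ≤ 4, ∀ q : Momentum, ‖iteratedFDeriv ℝ j (evalM (Kp n)) q‖ ≤ R.Gfr j * uPow j U * (4 : ℝ) ^ (((j : ℤ) - 2) * n))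
    {m : ℕ} (hm : m ≤ Nsc) {A : EuclideanSpace ℝ (Fin 2) → ℝ} (hA : ContDiff ℝ 3 A) {WA : ℝ}
    (hWA : ∀ j ≤ 3, ∀ x, ‖iteratedFDeriv ℝ j A x‖ ≤ WA) {i : ℕ} (hi : i ≤ 3) (x : EuclideanSpace ℝ (Fin 2)) :
    ‖iteratedFDeriv ℝ i (fun x => -evalM (Kp m) x * A x) x‖ ≤
      WA * ∑ j ∈ range (i + 1), (i.choose j : ℝ) * (R.Gfr j * uPow j U * (((2 : ℝ) ^ m) ^ (2 * j) / ((2 : ℝ) ^ m) ^ 4)) := by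
  have h := norm_iteratedFDeriv_framePiece_mul_le hS hm hA hWA hi x
  simp_rw [four_zpow_eq_two_pow_div] at h
  exact h

/-- The product table is entrywise non-negative (`R.WF`, `W_A ≥ 0`). -/
theorem framePieceW_nonneg {R : RenConsts} (hRwf : R.WF) (U : ℝ) {WA : ℝ} (hWA0 : 0 ≤ WA) (m i : ℕ) :
    0 ≤ WA * ∑ j ∈ range (i + 1), (i.choose j : ℝ) * (R.Gfr j * uPow j U * (((2 : ℝ) ^ m) ^ (2 * j) / ((2 : ℝ) ^ m) ^ 4)) := by
  have hG0 : ∀ j, 0 ≤ R.Gfr j := hRwf.2.2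
  refine mul_nonneg hWA0 (sum_nonneg fun j _ => ?_)
  have h1 : 0 ≤ uPow j U := by unfold uPow; split_ifs <;> positivity
  have := hG0 j
  positivity

/-! ## §2 The pieces of an admissible frame -/

section Frame

variable [NeZero L] [NeZero N] {R : RenConsts} {U μ β : ℝ} {Nsc : ℕ} {Kp : ℕ → TrigPolyC4v} {B WA : ℝ}

/-- `0 < klE0 ≤ 2` and `0 < 2·klE0`. -/
theorem klE0_facts : (0 : ℝ) < klE0 ∧ klE0 ≤ 2 ∧ (0 : ℝ) < 2 * klE0 := by norm_num [klE0]

omit [NeZero L] [NeZero N] in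
/-- **The increment of the padded pieces is the padded piece of the increment family** (`b_{m+1} = bₘ + (−Kₘ)`). -/
theorem paddedPiece_frame_succ_sub (μ β : ℝ) (Kp : ℕ → TrigPolyC4v) (A : EuclideanSpace ℝ (Fin 2) → ℝ) (m : ℕ)
    (q₀ : TorusSite 1 N) (qv : TorusSite 2 L) :
    paddedPiece L M N β (fun ω y => ((β * (L : ℝ) ^ 2 : ℝ) : ℂ) *
              (((bgmCutoff₂ klE0 (fbPt ω ((fun q : EuclideanSpace ℝ (Fin 2) => frameLevel μ 0 q - ∑ n ∈ range (m + 1), evalM (Kp n) q) (WithLp.toLp 2 (torusCentredMomentum L y)))) : ℝ) : ℂ) *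
                ((A (WithLp.toLp 2 (torusCentredMomentum L y)) : ℝ) : ℂ))) q₀ qv -
      paddedPiece L M N β (fun ω y => ((β * (L : ℝ) ^ 2 : ℝ) : ℂ) *
              (((bgmCutoff₂ klE0 (fbPt ω ((fun q : EuclideanSpace ℝ (Fin 2) => frameLevel μ 0 q - ∑ n ∈ range m, evalM (Kp n) q) (WithLp.toLp 2 (torusCentredMomentum L y)))) : ℝ) : ℂ) *
                ((A (WithLp.toLp 2 (torusCentredMomentum L y)) : ℝ) : ℂ))) q₀ qv =
      paddedPiece L M N β (fun ω y => ((β * (L : ℝ) ^ 2 : ℝ) : ℂ) *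
              ((((bgmCutoff₂ klE0 (fbPt ω ((fun q : EuclideanSpace ℝ (Fin 2) => frameLevel μ 0 q - ∑ n ∈ range m, evalM (Kp n) q) (WithLp.toLp 2 (torusCentredMomentum L y)) + (fun q : EuclideanSpace ℝ (Fin 2) => -evalM (Kp m) q) (WithLp.toLp 2 (torusCentredMomentum L y)))) : ℝ) : ℂ) -
                ((bgmCutoff₂ klE0 (fbPt ω ((fun q : EuclideanSpace ℝ (Fin 2) => frameLevel μ 0 q - ∑ n ∈ range m, evalM (Kp n) q) (WithLp.toLp 2 (torusCentredMomentum L y)))) : ℝ) : ℂ)) *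
                ((A (WithLp.toLp 2 (torusCentredMomentum L y)) : ℝ) : ℂ))) q₀ qv := by
  rw [← paddedPiece_sub]
  congr 1
  funext ω y
  simp only [frameBandSeq_succ μ Kp m]
  ring

/-- **The first space moment of the `m`-th multiplier INCREMENT of an admissible frame** (`m ≤ N_sc`):
`(β/N)·Σ|b̃_l|·‖S[P_{m+1} − P_m]‖ ≤ C₁'(B)·W_A·36864·S⁴·(U² + |U|/2ᵐ)`. -/
theorem spaceMoment_multIncrPiece_frame_le (hRwf : R.WF) (hU1 : |U| ≤ 1)
    (hS : ∀ n ≤ Nsc, ∀ j ≤ 4, ∀ q : Momentum, ‖iteratedFDeriv ℝ j (evalM (Kp n)) q‖ ≤ R.Gfr j * uPow j U * (4 : ℝ) ^ (((j : ℤ) - 2) * n))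
    (hμ : μ ∈ klWindowC) (hκU : 16 / 15 * (R.Gfr 0 * |U|) ≤ 1 / 50) (hL : (2 : ℝ) ^ 15 ≤ L)
    (hβ2 : 2 ≤ β) (hβM : β ^ 3 ≤ (M : ℝ)) (hMN : 2 * M ≤ N) (hB1 : 1 ≤ B)
    (hB : ∀ i ≤ 5, ∀ u, ‖iteratedDeriv i (bgmCutoffSqUnit klE0) u‖ ≤ B)
    {A : EuclideanSpace ℝ (Fin 2) → ℝ} (hA : ContDiff ℝ 3 A) (hWA0 : 0 ≤ WA) (hWA : ∀ j ≤ 3, ∀ x, ‖iteratedFDeriv ℝ j A x‖ ≤ WA)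
    {m : ℕ} (hm : m ≤ Nsc) {l l' : Fin 2} (hll' : l ≠ l') :
    β / N * ∑ a : TorusSite 1 N, ∑ bv : TorusSite 2 L,
        |(((bv l).valMinAbs : ℤ) : ℝ)| *
          ‖∑ q₀ : TorusSite 1 N, ∑ qv : TorusSite 2 L, torusChar q₀ a * torusChar qv bv *
            (paddedPiece L M N β (fun ω y => ((β * (L : ℝ) ^ 2 : ℝ) : ℂ) *
              (((bgmCutoff₂ klE0 (fbPt ω ((fun q : EuclideanSpace ℝ (Fin 2) => frameLevel μ 0 q - ∑ n ∈ range (m + 1), evalM (Kp n) q) (WithLp.toLp 2 (torusCentredMomentum L y)))) : ℝ) : ℂ) *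
                ((A (WithLp.toLp 2 (torusCentredMomentum L y)) : ℝ) : ℂ))) q₀ qv -
              paddedPiece L M N β (fun ω y => ((β * (L : ℝ) ^ 2 : ℝ) : ℂ) *
              (((bgmCutoff₂ klE0 (fbPt ω ((fun q : EuclideanSpace ℝ (Fin 2) => frameLevel μ 0 q - ∑ n ∈ range m, evalM (Kp n) q) (WithLp.toLp 2 (torusCentredMomentum L y)))) : ℝ) : ℂ) *
                ((A (WithLp.toLp 2 (torusCentredMomentum L y)) : ℝ) : ℂ))) q₀ qv)‖ ≤
      (1 / 4 * Real.sqrt (216 * (1 / (2 * klE0) + 1 / 2)) *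
          ∑ e : Fin 2 × Fin 2, (uvLinV (2 * klE0) (1 + (e.1 : ℕ) + (e.2 : ℕ)) *
              (klE0 / 2 * (((1 + ((e.1 : ℕ) + (e.2 : ℕ)) + 1).factorial : ℝ) * B * (2 / klE0) ^ (1 + ((e.1 : ℕ) + (e.2 : ℕ)) + 1))) +
            uvLinD (2 * klE0) (1 + (e.1 : ℕ) + (e.2 : ℕ)) *
              (klE0 / 2 * (((1 + ((e.1 : ℕ) + (e.2 : ℕ)) + 2).factorial : ℝ) * B * (2 / klE0) ^ (1 + ((e.1 : ℕ) + (e.2 : ℕ)) + 2))))) *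
        (WA * (36864 * (1 + R.Gfr 0 + R.Gfr 1 + R.Gfr 2 + R.Gfr 3) ^ 4 * (U ^ 2 + |U| * (1 / 2 : ℝ) ^ m))) := by
  obtain ⟨hE, hE2, hΛ⟩ := klE0_facts
  have hR0 : ∀ j, 0 ≤ R.Gfr j := hRwf.2.2
  have hL8 : 8 < L := by
    have : (8 : ℝ) < L := lt_of_lt_of_le (by norm_num) hL
    exact_mod_cast this
  have hB0 : 0 ≤ B := zero_le_one.trans hB1
  simp only [paddedPiece_frame_succ_sub]
  have hDc0 : 0 ≤ ((4 + 4 / 3 * (R.Gfr 1 + R.Gfr 2 + R.Gfr 3)) * (2 : ℝ) ^ m) := by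
    have := hR0 1; have := hR0 2; have := hR0 3; positivity
  have hW0 : ∀ i, 0 ≤ (fun i => WA * ∑ j ∈ range (i + 1), (i.choose j : ℝ) * (R.Gfr j * uPow j U * (((2 : ℝ) ^ m) ^ (2 * j) / ((2 : ℝ) ^ m) ^ 4))) i := fun i => framePieceW_nonneg hRwf U hWA0 m i
  have hstep := spaceMoment_multIncrPiece_le (L := L) (M := M) (N := N) hβ2 hE hE2 hL8 hβM hMN hB1 hB le_rfl
    (contDiff_frameBandSeq μ Kp m) (contDiff_evalM_neg (Kp m)) hA (D := ((4 + 4 / 3 * (R.Gfr 1 + R.Gfr 2 + R.Gfr 3)) * (2 : ℝ) ^ m))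
    (fun s hs i hi1 hi3 x => norm_iteratedFDeriv_frameBandInterp_le hRwf hU1 hS hm hs hi1 hi3 x)
    (W := (fun i => WA * ∑ j ∈ range (i + 1), (i.choose j : ℝ) * (R.Gfr j * uPow j U * (((2 : ℝ) ^ m) ^ (2 * j) / ((2 : ℝ) ^ m) ^ 4))))
    (fun i hi x => framePieceW_bound hS hm hA hWA hi x)
    (fun s hs p hp => frameBandInterp_offShell_of_frameOK hR0 hS hμ hκU hL hm hs p hp) hll' (R := 4 ^ m)
    (Nat.one_le_pow _ _ (by norm_num))
  refine hstep.trans ?_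
  have hQ := fun k => multAmp_nonneg hB0 hE hDc0 hW0 1 k
  have hQ' := fun k => multAmp_nonneg hB0 hE hDc0 hW0 2 k
  refine (uvSpaceMomentConst_le_linear hΛ (4 ^ m) hQ hQ').trans ?_
  have h4m : ((4 ^ m : ℕ) : ℝ) = ((2 : ℝ) ^ m) ^ 2 := by
    push_cast; rw [← pow_mul, mul_comm, pow_mul]; norm_num
  rw [h4m, mul_assoc (1 / 4 * Real.sqrt (216 * (1 / (2 * klE0) + 1 / 2))), mul_sum,
    mul_assoc (1 / 4 * Real.sqrt (216 * (1 / (2 * klE0) + 1 / 2))), sum_mul]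
  refine mul_le_mul_of_nonneg_left (sum_le_sum fun e _ => ?_) (by positivity)
  have hk' : (e.1 : ℕ) + (e.2 : ℕ) ≤ 2 := by have := e.1.isLt; have := e.2.isLt; omega
  have hV := scaledMultAmp_le (U := U) (B := B) hRwf hWA0 hB1 m 1 hk'
  have hD := scaledMultAmp_le (U := U) (B := B) hRwf hWA0 hB1 m 2 hk'
  have hV0 := uvLinV_nonneg hΛ (1 + (e.1 : ℕ) + (e.2 : ℕ))
  have hD0 := uvLinD_nonneg hΛ (1 + (e.1 : ℕ) + (e.2 : ℕ))
  rw [show 1 + (e.1 : ℕ) + (e.2 : ℕ) = 1 + ((e.1 : ℕ) + (e.2 : ℕ)) by ring] at hV0 hD0 ⊢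
  set T := WA * (36864 * (1 + R.Gfr 0 + R.Gfr 1 + R.Gfr 2 + R.Gfr 3) ^ 4 * (U ^ 2 + |U| * (1 / 2 : ℝ) ^ m)) with hT
  set Y2 := ((2 : ℝ) ^ m) ^ 2 with hY2
  set ρ := (1 / (4 * ((2 : ℝ) ^ m) ^ 2)) ^ ((e.1 : ℕ) + (e.2 : ℕ)) with hρ
  set QV := multAmp B klE0 ((4 + 4 / 3 * (R.Gfr 1 + R.Gfr 2 + R.Gfr 3)) * (2 : ℝ) ^ m)
    (fun i => WA * ∑ j ∈ range (i + 1), (i.choose j : ℝ) * (R.Gfr j * uPow j U * (((2 : ℝ) ^ m) ^ (2 * j) / ((2 : ℝ) ^ m) ^ 4)))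
    1 (1 + ((e.1 : ℕ) + (e.2 : ℕ))) with hQV
  set QD := multAmp B klE0 ((4 + 4 / 3 * (R.Gfr 1 + R.Gfr 2 + R.Gfr 3)) * (2 : ℝ) ^ m)
    (fun i => WA * ∑ j ∈ range (i + 1), (i.choose j : ℝ) * (R.Gfr j * uPow j U * (((2 : ℝ) ^ m) ^ (2 * j) / ((2 : ℝ) ^ m) ^ 4)))
    2 (1 + ((e.1 : ℕ) + (e.2 : ℕ))) with hQD
  set LV := uvLinV (2 * klE0) (1 + ((e.1 : ℕ) + (e.2 : ℕ))) with hLV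
  set LD := uvLinD (2 * klE0) (1 + ((e.1 : ℕ) + (e.2 : ℕ))) with hLD
  have hV' : Y2 * ρ * QV ≤ klE0 / 2 * (((1 + ((e.1 : ℕ) + (e.2 : ℕ)) + 1).factorial : ℝ) * B *
      (2 / klE0) ^ (1 + ((e.1 : ℕ) + (e.2 : ℕ)) + 1)) * T := hV
  have hD' : Y2 * ρ * QD ≤ klE0 / 2 * (((1 + ((e.1 : ℕ) + (e.2 : ℕ)) + 2).factorial : ℝ) * B *
      (2 / klE0) ^ (1 + ((e.1 : ℕ) + (e.2 : ℕ)) + 2)) * T := hD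
  calc Y2 * (ρ * (LV * QV + LD * QD)) = LV * (Y2 * ρ * QV) + LD * (Y2 * ρ * QD) := by ring
    _ ≤ LV * (klE0 / 2 * (((1 + ((e.1 : ℕ) + (e.2 : ℕ)) + 1).factorial : ℝ) * B * (2 / klE0) ^ (1 + ((e.1 : ℕ) + (e.2 : ℕ)) + 1)) * T) +
        LD * (klE0 / 2 * (((1 + ((e.1 : ℕ) + (e.2 : ℕ)) + 2).factorial : ℝ) * B * (2 / klE0) ^ (1 + ((e.1 : ℕ) + (e.2 : ℕ)) + 2)) * T) :=
        add_le_add (mul_le_mul_of_nonneg_left hV' hV0) (mul_le_mul_of_nonneg_left hD' hD0)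
    _ = _ := by ring

/-- **The first space moment of the BARE multiplier piece** (band `e − μ`, scale `R = 1`): a closed constant in `B`, `W_A`. -/
theorem spaceMoment_multBasePiece_frame_le (hμ : μ ∈ klWindowC) (hL : (2 : ℝ) ^ 15 ≤ L) (hβ2 : 2 ≤ β) (hβM : β ^ 3 ≤ (M : ℝ))
    (hMN : 2 * M ≤ N) (hB1 : 1 ≤ B) (hB : ∀ i ≤ 5, ∀ u, ‖iteratedDeriv i (bgmCutoffSqUnit klE0) u‖ ≤ B)
    {A : EuclideanSpace ℝ (Fin 2) → ℝ} (hA : ContDiff ℝ 3 A) (hWA : ∀ j ≤ 3, ∀ x, ‖iteratedFDeriv ℝ j A x‖ ≤ WA)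
    {l l' : Fin 2} (hll' : l ≠ l') :
    β / N * ∑ a : TorusSite 1 N, ∑ bv : TorusSite 2 L,
        |(((bv l).valMinAbs : ℤ) : ℝ)| *
          ‖∑ q₀ : TorusSite 1 N, ∑ qv : TorusSite 2 L, torusChar q₀ a * torusChar qv bv *
            paddedPiece L M N β (fun ω y => ((β * (L : ℝ) ^ 2 : ℝ) : ℂ) *
              (((bgmCutoff₂ klE0 (fbPt ω (frameLevel μ 0 (WithLp.toLp 2 (torusCentredMomentum L y)))) : ℝ) : ℂ) *
                ((A (WithLp.toLp 2 (torusCentredMomentum L y)) : ℝ) : ℂ))) q₀ qv‖ ≤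
      uvSpaceMomentConst (2 * klE0) 1 (uvPieceSq (2 * klE0) (multAmp B klE0 4 (fun _ => WA) 0) (multAmp B klE0 4 (fun _ => WA) 1)) := by
  obtain ⟨hE, hE2, hΛ⟩ := klE0_facts
  have hL8 : 8 < L := by
    have : (8 : ℝ) < L := lt_of_lt_of_le (by norm_num) hL
    exact_mod_cast this
  exact spaceMoment_multBasePiece_le (L := L) (M := M) (N := N) hβ2 hE hE2 hL8 hβM hMN hB1 hB le_rfl (contDiff_frameLevel μ 0) hA
    (D := 4) (fun i hi1 _ x => norm_iteratedFDeriv_frameLevel_zero_le_pow μ hi1 x) (W := fun _ => WA) (fun i hi x => hWA i hi x)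
    (fun p hp => frameLevel_zero_offShell_of_window hμ hL p hp) hll' le_rfl

end Frame

/-! ## §3 The telescoped bound in the grid units -/

/-- **The first space moment of the padded scale-`0` multiplier piece of an admissible frame**, telescoped over the frame pieces:
`(β/N)·Σ_{a,b⃗}|b̃_l|·‖S[P_K](a,b⃗)‖ ≤ C₀'(B,W_A) + C₁'(B)·W_A·36864·S⁴·((N_sc+1)U² + 2|U|)`. -/
theorem spaceMoment_multiplier_padded_le [NeZero L] [NeZero N] {R : RenConsts} {U μ β : ℝ} {Nsc : ℕ} {K : TrigPolyC4v}
    (hK : FrameOK R U Nsc μ K) (hRwf : R.WF) (hU1 : |U| ≤ 1) (hμ : μ ∈ klWindowC) (hκU : 16 / 15 * (R.Gfr 0 * |U|) ≤ 1 / 50)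
    (hL : (2 : ℝ) ^ 15 ≤ L) (hβ2 : 2 ≤ β) (hβM : β ^ 3 ≤ (M : ℝ)) (hMN : 2 * M ≤ N) {B : ℝ} (hB1 : 1 ≤ B)
    (hB : ∀ i ≤ 5, ∀ u, ‖iteratedDeriv i (bgmCutoffSqUnit klE0) u‖ ≤ B)
    {A : EuclideanSpace ℝ (Fin 2) → ℝ} (hA : ContDiff ℝ 3 A) {WA : ℝ} (hWA0 : 0 ≤ WA) (hWA : ∀ j ≤ 3, ∀ x, ‖iteratedFDeriv ℝ j A x‖ ≤ WA)
    {l l' : Fin 2} (hll' : l ≠ l') :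
    β / N * ∑ a : TorusSite 1 N, ∑ bv : TorusSite 2 L,
        |(((bv l).valMinAbs : ℤ) : ℝ)| *
          ‖∑ q₀ : TorusSite 1 N, ∑ qv : TorusSite 2 L, torusChar q₀ a * torusChar qv bv *
            paddedPiece L M N β (fun ω y => ((β * (L : ℝ) ^ 2 : ℝ) : ℂ) *
              (((bgmCutoff₂ klE0 (fbPt ω (frameLevel μ K (WithLp.toLp 2 (torusCentredMomentum L y)))) : ℝ) : ℂ) *
                ((A (WithLp.toLp 2 (torusCentredMomentum L y)) : ℝ) : ℂ))) q₀ qv‖ ≤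
      uvSpaceMomentConst (2 * klE0) 1 (uvPieceSq (2 * klE0) (multAmp B klE0 4 (fun _ => WA) 0) (multAmp B klE0 4 (fun _ => WA) 1)) +
        (1 / 4 * Real.sqrt (216 * (1 / (2 * klE0) + 1 / 2)) *
          ∑ e : Fin 2 × Fin 2, (uvLinV (2 * klE0) (1 + (e.1 : ℕ) + (e.2 : ℕ)) *
              (klE0 / 2 * (((1 + ((e.1 : ℕ) + (e.2 : ℕ)) + 1).factorial : ℝ) * B * (2 / klE0) ^ (1 + ((e.1 : ℕ) + (e.2 : ℕ)) + 1))) +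
            uvLinD (2 * klE0) (1 + (e.1 : ℕ) + (e.2 : ℕ)) *
              (klE0 / 2 * (((1 + ((e.1 : ℕ) + (e.2 : ℕ)) + 2).factorial : ℝ) * B * (2 / klE0) ^ (1 + ((e.1 : ℕ) + (e.2 : ℕ)) + 2))))) *
          (WA * (36864 * (1 + R.Gfr 0 + R.Gfr 1 + R.Gfr 2 + R.Gfr 3) ^ 4 * (((Nsc : ℝ) + 1) * U ^ 2 + 2 * |U|))) := by
  obtain ⟨-, Kp, hsum, hS⟩ := hK
  have hβ0 : 0 < β := by linarith
  have hNpos : (0 : ℝ) < N := by exact_mod_cast Nat.pos_of_ne_zero (NeZero.ne N)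
  -- the full band is the last partial band
  simp only [← frameBandSeq_last_eq_frameLevel μ hsum]
  -- telescoping of the weighted `ℓ¹` norm
  have hw0 : ∀ (a : TorusSite 1 N) (bv : TorusSite 2 L), 0 ≤ (fun (_ : TorusSite 1 N) (bv : TorusSite 2 L) =>
      |(((bv l).valMinAbs : ℤ) : ℝ)|) a bv := fun a bv => abs_nonneg _
  have htel := sum_sum_wt_norm_charSum_telescope_le _ hw0
    (fun m => paddedPiece L M N β (fun ω y => ((β * (L : ℝ) ^ 2 : ℝ) : ℂ) *
              (((bgmCutoff₂ klE0 (fbPt ω ((fun q : EuclideanSpace ℝ (Fin 2) => frameLevel μ 0 q - ∑ n ∈ range m, evalM (Kp n) q) (WithLp.toLp 2 (torusCentredMomentum L y)))) : ℝ) : ℂ) *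
                ((A (WithLp.toLp 2 (torusCentredMomentum L y)) : ℝ) : ℂ)))) (Nsc + 1)
  simp only [Pi.sub_apply] at htel
  refine (mul_le_mul_of_nonneg_left htel (by positivity)).trans ?_
  rw [mul_add]
  refine add_le_add ?_ ?_
  · -- the bare piece
    simp only [sum_range_zero, sub_zero]
    exact spaceMoment_multBasePiece_frame_le (L := L) (M := M) (N := N) hμ hL hβ2 hβM hMN hB1 hB hA hWA hll'
  · -- the increments, summed over `m ≤ N_sc`
    rw [mul_sum]
    refine (sum_le_sum fun m hm => spaceMoment_multIncrPiece_frame_le (L := L) (M := M) (N := N) hRwf hU1 hS hμ hκU hL hβ2 hβM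
      hMN hB1 hB hA hWA0 hWA (Nat.lt_succ_iff.1 (mem_range.1 hm)) hll').trans ?_
    rw [← mul_sum, ← mul_sum, ← mul_sum]
    refine mul_le_mul_of_nonneg_left (mul_le_mul_of_nonneg_left (mul_le_mul_of_nonneg_left ?_ (by positivity)) hWA0) ?_
    · -- `Σ_{m ≤ N_sc} (U² + |U|/2ᵐ) ≤ (N_sc+1)U² + 2|U|`
      rw [sum_add_distrib, sum_const, card_range, nsmul_eq_mul, ← mul_sum]
      have hgeo : ∑ m ∈ range (Nsc + 1), (1 / 2 : ℝ) ^ m ≤ 2 := by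
        rw [geom_sum_eq (by norm_num) (Nsc + 1)]
        have : 0 ≤ (1 / 2 : ℝ) ^ (Nsc + 1) := by positivity
        have h : ((1 / 2 : ℝ) ^ (Nsc + 1) - 1) / (1 / 2 - 1) = 2 * (1 - (1 / 2 : ℝ) ^ (Nsc + 1)) := by field_simp; ring
        rw [h]; nlinarith
      push_cast
      nlinarith [abs_nonneg U, hgeo]
    · have hΛ := klE0_facts.2.2
      have hE := klE0_facts.1
      have hB0 : 0 ≤ B := zero_le_one.trans hB1
      refine mul_nonneg (by positivity) (sum_nonneg fun e _ => ?_)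
      have h1 := uvLinV_nonneg hΛ (1 + (e.1 : ℕ) + (e.2 : ℕ))
      have h2 := uvLinD_nonneg hΛ (1 + (e.1 : ℕ) + (e.2 : ℕ))
      positivity

end Summit.HubbardSuperconductivity.HubbardSuperconductivity.Theorems.EngineV8

end
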